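import Mathlib.Data.Fin.Embedding
import Mathlib.Logic.Equiv.Fin.Basic
import Literature.Barriers.ValiantsHypothesis.AlgebraicNaturalProofs
import Literature.Computability.AlgebraicComplexity.ArithCircuitProofs
import Literature.Computability.AlgebraicComplexity.StandardFamilies
import Literature.Computability.MetaComplexity.NWGenerator
import HarnessLib

/-!
# KRST's Reed–Solomon design indexed by monomials, and the padded permanent `Perm_[p]`
# (Kumar–Ramya–Saptharishi–Tengse 2022, §3.3–3.4)

Topic `Computability/AlgebraicComplexity`. The two concrete ingredients with which KRST
instantiate the Kabanets–Impagliazzo generator (`kiGenerator`, `KabanetsImpagliazzoGenerator.lean`):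

* `krstDesign p n : degLEMonomials n → (Fin p ↪ 𝔽_p × 𝔽_p)` — the Reed–Solomon `(p², p, n)`-design
  indexed by the exponent vectors `μ` of degree `≤ n` (the coordinates `c_μ` of the natural-proofs
  framework `Literature.Barriers.ValiantsHypothesis.degLEMonomials`): the block of `μ` is the graph
  `{(i, g_μ(i)) : i ∈ 𝔽_p}` of the polynomial `g_μ ∈ 𝔽_p[v]` with coefficient vector `μ` ("every
  set in the design can be interpreted as a univariate polynomial `g`", KRST §1.3; §3.3: "`S_g =
  {(i, g(i))}` … any two distinct univariates of degree less than `a` can agree on at most `a`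
  points"), realised by the tree's polynomial designs `polyBlock` / `isNWDesign_polyBlock`
  (`MetaComplexity/NWGenerator.lean`); `isNWDesign_krstDesign : n < p → IsNWDesign n (krstDesign p n)`.
* `perPad F (hmp : m * m ≤ p)` — `Perm_[p]`, the permanent `per_m` on the first `m²` of `p`
  block variables (KRST §3.4), with `complexity_perPad` (`= L(per_m)`) and
  `totalDegree_perPad_le` (`≤ m`).

## References

* [KumarRamyaSaptharishiTengse2022] M. Kumar, C. Ramya, R. Saptharishi, A. Tengse, *If VNP is
  hard, then so are equations for it*, STACS 2022, §3.3 (Reed–Solomon based designs), §3.4.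
-/

noncomputable section

namespace Literature.Computability.AlgebraicComplexity

open Literature.Barriers.ValiantsHypothesis Literature.Computability.MetaComplexity MvPolynomial


section Permanent

/-- The exponent vector `μ` (entries `≤ n`) read as a coefficient vector in `𝔽_p^{n+1}` (last
entry `0`): KRST's indexing of the Reed–Solomon design by monomials ("every set in the design can
be interpreted as a univariate polynomial `g` of appropriate degree over a finite field", §1.3;
§3.4 "`S_e` is an appropriate ordering of the Reed–Solomon based design").
[cite: KumarRamyaSaptharishiTengse2022, §3.3–3.4] -/
def expCoeffs (p n : ℕ) (μ : degLEMonomials n) : Fin (n + 1) → ZMod p :=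
  fun i => if h : (i : ℕ) < n then (((μ : Fin n →₀ ℕ) ⟨i, h⟩ : ℕ) : ZMod p) else 0

/-- Distinct exponent vectors of degree `≤ n < p` have distinct coefficient vectors mod `p`.
[cite: KumarRamyaSaptharishiTengse2022, §3.3] -/
theorem expCoeffs_injective {p n : ℕ} (hnp : n < p) : Function.Injective (expCoeffs p n) := by
  intro μ μ' h
  apply Subtype.ext
  ext i
  have hi := congrFun h ⟨i, Nat.lt_succ_of_lt i.isLt⟩
  simp only [expCoeffs, i.isLt, dif_pos, Fin.eta] at hi
  rw [ZMod.natCast_eq_natCast_iff'] at hi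
  have h1 : (μ : Fin n →₀ ℕ) i < p :=
    lt_of_le_of_lt ((Finsupp.le_degree i _).trans μ.2) hnp
  have h2 : (μ' : Fin n →₀ ℕ) i < p :=
    lt_of_le_of_lt ((Finsupp.le_degree i _).trans μ'.2) hnp
  rwa [Nat.mod_eq_of_lt h1, Nat.mod_eq_of_lt h2] at hi

/-- **KRST's Reed–Solomon design** indexed by the coordinates of the regime `d = n`: the block of
`μ` is the graph `{(i, g_μ(i)) : i ∈ 𝔽_p}` of the polynomial `g_μ ∈ 𝔽_p[v]` of degree `≤ n` with
coefficient vector `μ` — `p` points of the universe `𝔽_p × 𝔽_p` (the tree's `polyBlock` over all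
of `𝔽_p`). [cite: KumarRamyaSaptharishiTengse2022, §3.3] -/
def krstDesign (p n : ℕ) [Fact p.Prime] (μ : degLEMonomials n) : Fin p ↪ ZMod p × ZMod p :=
  polyBlock (ZMod.finEquiv p).toEquiv.toEmbedding (expCoeffs p n μ)

/-- The Reed–Solomon design is a `(p², p, n)`-design: two blocks meet in `≤ n` points ("any two
distinct univariate polynomials of degree less than `a` can agree on at most `a` points").
[cite: KumarRamyaSaptharishiTengse2022, §3.3] -/
theorem isNWDesign_krstDesign (p n : ℕ) [Fact p.Prime] (hnp : n < p) :
    IsNWDesign n (krstDesign p n) :=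
  (isNWDesign_polyBlock n _).comp_injective (expCoeffs_injective hnp)

variable (F : Type*) [CommSemiring F]

/-- The block embedding of the `m²` permanent variables into `p ≥ m²` block positions (KRST use
"`Perm_[p]`, `Perm_m` applied to the first `m²` variables"). [cite: KumarRamyaSaptharishiTengse2022, §3.4] -/
def permPad {m p : ℕ} (hmp : m * m ≤ p) : Fin m × Fin m ↪ Fin p :=
  finProdFinEquiv.toEmbedding.trans (Fin.castLEEmb hmp)

/-- **The padded permanent `Perm_[p]`**: `per_m` on the first `m²` of `p` block variables.
[cite: KumarRamyaSaptharishiTengse2022, §3.4] -/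
def perPad {m p : ℕ} (hmp : m * m ≤ p) : MvPolynomial (Fin p) F :=
  rename (permPad hmp) (perPoly (Fin m) F)

variable {F}

/-- `Perm_[p]` has the complexity of `per_m` (injective renaming). [cite: KumarRamyaSaptharishiTengse2022, §3.5] -/
theorem complexity_perPad {m p : ℕ} (hmp : m * m ≤ p) :
    complexity (perPad F hmp) = complexity (perPoly (Fin m) F) :=
  complexity_rename_of_injective_holds (permPad hmp).injective _

/-- `deg Perm_[p] ≤ m`. [cite: KumarRamyaSaptharishiTengse2022, §3.5] -/
theorem totalDegree_perPad_le {m p : ℕ} (hmp : m * m ≤ p) : (perPad F hmp).totalDegree ≤ m := by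
  refine (totalDegree_rename_le _ _).trans ?_
  simpa using (perPoly_isHomogeneous (n := Fin m) (k := F)).totalDegree_le

end Permanent


end Literature.Computability.AlgebraicComplexity

end
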